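import Summits.NavierStokesRegularity.NavierStokesRegularity.Theorems.CoriolisHeadTypeIRateOfGradientDecay
import Summits.NavierStokesRegularity.NavierStokesRegularity.Theorems.CoriolisHeadTypeIRateLogTransport
import HarnessLib

/-!
# CoriolisHeadTypeIRateLogRate — crux `NoCoRotatingCore` (stmt-NavierStokesRegularity-22676), line
# `far_field_constancy` v2 (skeleton 15c9a82ad206abb9), stub K1c `stub_typeIRate`:
# **K1a ∧ (U → b) give the Type-I rate UP TO A LOGARITHM — unconditionally**

`TypeIRate.typeIRate_log_of_scaleNaturalDecay`: under EXACTLY the hypotheses of the registered stub K1c (bounded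
smooth div-free rotated Leray profile, `ν, a > 0`, `B` skew, K1a `‖y‖‖DU‖ + ‖y‖²‖D²U‖ → 0`, and `U → b`) one has
`‖U(y) − b‖ ≤ K (1 + log(1 + ‖y‖))/(1 + ‖y‖)` for all `y`.  K1c as registered asks for the same WITHOUT the
logarithm; so the registered stub is borderline by exactly one logarithm, and this file proves everything but it.

Mechanism.  K1a gives `|ΔP| = |tr((DU)²)| ≤ 3‖DU‖² ≤ K₂(1+r)^{−2}` globally; the landed pressure-gradient rate
(`abs_fderiv_sub_inner_le`, exponent `q = 2`, critical) gives `‖∇P(y) − g‖ ≤ C_P/‖y‖`, `g = −(ab + Bb)`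
(`gradient_limit_eq`).  Along the spiral characteristics of `V = a(y − c) − B(y − c)` (`ac − Bc = −b`) the system
reads `dW/ds + (a + B)W = νΔU − DU·W − (∇P − g)` (`transport_form_of_rotated`): the forcing `∇P − g` is CRITICAL
(`O(1/r)` against the damping `e^{−as} = R/r`), so each unit of flow time contributes equally and the integral is
`(C_P/a) log(r/R)` — the logarithm.  The critical-forcing transport estimates (log loss, linear term `DU·W` absorbed by the
shell-maximum bootstrap) are `CoriolisHeadTypeIRateLogTransport`; this file bounds the pressure and assembles.

HONEST FRAMING.  This does NOT close K1c (the logarithm is exactly what the registered statement forbids, and the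
residual stub `stub_pineauVicolConjecture` consumes the pure Type-I class `‖U‖ ≤ K/(1 + ‖y‖)`); together with
`typeIRate_of_third_order_decay` (third-order scale-natural decay removes the logarithm) it brackets K1c for the
planner.  Nothing here proves K1a, `NoCoRotatingCore`, Pineau–Vicol's Conjecture 1.1 or Navier–Stokes regularity.

References: line card `Cruxes/NoCoRotatingCore/Lines/far_field_constancy.md` (K1c block: "the homogeneous
resonance"); B. Pineau, V. Vicol, arXiv:2607.09619 (2026), (1.8), Conj. 1.1, Prop. 3.1 [PineauVicol2026].
-/

noncomputable section

open MeasureTheory Set Function Filter Topology Metric InnerProductSpace Real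
open scoped RealInnerProductSpace Laplacian ContDiff

-- the summit and its single sub-problem share the name (CONVENTIONS §1), as in every Theorems file
set_option linter.dupNamespace false

namespace Summit.NavierStokesRegularity.NavierStokesRegularity.Theorems.CoriolisHead

namespace TypeIRate

open Literature.Analysis.FluidPDE
/-! ## The profile theorem: K1a ∧ (U → b) ⇒ Type-I rate with a logarithm -/

section Profile

variable {ν a : ℝ} {B : EuclideanSpace ℝ (Fin 3) →L[ℝ] EuclideanSpace ℝ (Fin 3)}
  {U : EuclideanSpace ℝ (Fin 3) → EuclideanSpace ℝ (Fin 3)} {P : EuclideanSpace ℝ (Fin 3) → ℝ}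

/-- **Critical pressure-gradient rate from K1a.**  For a bounded smooth div-free rotated profile with K1a,
`‖∇P(y) − g‖ ≤ C_P/‖y‖` for `‖y‖ ≥ 1`, where `g` is the far-field limit of `∇P`: K1a and compactness give
`|ΔP| ≤ 3‖DU‖² ≤ K₂(1+r)^{−2}` globally, and the landed telescoping estimate `abs_fderiv_sub_inner_le` with the
critical exponent `q = 2` gives the rate. -/
theorem norm_gradient_sub_le_of_scaleNaturalDecay (hν : 0 < ν) (ha : 0 < a)
    (hB : ∀ x, inner ℝ (B x) x = 0) (hU : ContDiff ℝ (⊤ : ℕ∞) U) (hP : ContDiff ℝ 2 P)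
    (hdiv : VectorCalculus.IsDivFree U)
    (heq : ∀ y, -(ν • (Δ U) y) + a • U y + a • fderiv ℝ U y y + (B (U y) - fderiv ℝ U y (B y)) +
      convect U U y + gradient P y = 0)
    (hbdd : ∃ M : ℝ, ∀ y, ‖U y‖ ≤ M)
    (hdecay : ∀ ε : ℝ, 0 < ε → ∃ R : ℝ, ∀ y : EuclideanSpace ℝ (Fin 3), R ≤ ‖y‖ →
      ‖y‖ * ‖fderiv ℝ U y‖ + ‖y‖ ^ 2 * ‖iteratedFDeriv ℝ 2 U y‖ ≤ ε) :
    ∃ (g : EuclideanSpace ℝ (Fin 3)) (CP : ℝ), 0 ≤ CP ∧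
      (∀ ε : ℝ, 0 < ε → ∃ R : ℝ, ∀ w : EuclideanSpace ℝ (Fin 3), R ≤ ‖w‖ → ‖gradient P w - g‖ ≤ ε) ∧
      ∀ y : EuclideanSpace ℝ (Fin 3), 1 ≤ ‖y‖ → ‖gradient P y - g‖ ≤ CP / ‖y‖ := by
  have hU3 : ContDiff ℝ 3 U := hU.of_le (by norm_cast)
  have hP1 : ContDiff ℝ 1 P := hP.of_le one_le_two
  have hPinf : ContDiff ℝ ∞ P := contDiff_pressure_of_rotated hU hP1 heq
  obtain ⟨g, hg⟩ := FarFieldLimit.exists_gradient_pressure_limit hν ha hB hU hP hdiv heq hbdd hdecay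
  -- K1a at level `1` and the gradient bound on the ball
  obtain ⟨R₁, hR₁1, hR₁⟩ := FarFieldLimit.exists_radius_decay hdecay one_pos
  obtain ⟨D₀, hD₀⟩ := (isCompact_closedBall (0 : EuclideanSpace ℝ (Fin 3)) R₁).exists_bound_of_continuousOn
    ((hU.continuous_fderiv (by simp)).continuousOn)
  have hD₀0 : 0 ≤ D₀ := (norm_nonneg _).trans (hD₀ 0 (mem_closedBall_self (by linarith)))
  -- global bound `|ΔP| ≤ K₂ (1+r)^{-2}`
  set K₂ : ℝ := 12 + 3 * D₀ ^ 2 * (1 + R₁) ^ 2 with hK₂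
  have hK₂0 : 0 ≤ K₂ := by positivity
  have hΔ : ∀ w : EuclideanSpace ℝ (Fin 3), |(Δ P) w| ≤ K₂ / (1 + ‖w‖) ^ (2 : ℝ) := by
    intro w
    rw [Real.rpow_two]
    have hsq := abs_laplacian_pressure_le_sq hU3 hP hdiv heq w
    have h1w : 0 < (1 + ‖w‖) ^ 2 := by positivity
    rw [le_div_iff₀ h1w]
    by_cases hw : R₁ ≤ ‖w‖
    · have hw1 : 1 ≤ ‖w‖ := hR₁1.trans hw
      have hwpos : 0 < ‖w‖ := by linarith
      have hDw : ‖fderiv ℝ U w‖ ≤ 1 / ‖w‖ := (hR₁ w hw).1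
      have hDw' : ‖fderiv ℝ U w‖ * ‖w‖ ≤ 1 := by rwa [le_div_iff₀ hwpos] at hDw
      have hsq2 : ‖fderiv ℝ U w‖ ^ 2 * ‖w‖ ^ 2 ≤ 1 := by
        have h0 : 0 ≤ ‖fderiv ℝ U w‖ * ‖w‖ := by positivity
        nlinarith
      have h12 : (1 + ‖w‖) ^ 2 ≤ 4 * ‖w‖ ^ 2 := by nlinarith
      calc |(Δ P) w| * (1 + ‖w‖) ^ 2 ≤ 3 * ‖fderiv ℝ U w‖ ^ 2 * (4 * ‖w‖ ^ 2) :=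
            mul_le_mul hsq h12 (by positivity) (by positivity)
        _ = 12 * (‖fderiv ℝ U w‖ ^ 2 * ‖w‖ ^ 2) := by ring
        _ ≤ 12 * 1 := by nlinarith
        _ ≤ K₂ := by rw [hK₂]; nlinarith [sq_nonneg D₀, sq_nonneg (1 + R₁)]
    · rw [not_le] at hw
      have hDw : ‖fderiv ℝ U w‖ ≤ D₀ := hD₀ w (mem_closedBall_zero_iff.2 hw.le)
      have hsq2 : ‖fderiv ℝ U w‖ ^ 2 ≤ D₀ ^ 2 := pow_le_pow_left₀ (norm_nonneg _) hDw 2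
      have h12 : (1 + ‖w‖) ^ 2 ≤ (1 + R₁) ^ 2 := pow_le_pow_left₀ (by positivity) (by linarith) 2
      calc |(Δ P) w| * (1 + ‖w‖) ^ 2 ≤ 3 * ‖fderiv ℝ U w‖ ^ 2 * (1 + R₁) ^ 2 :=
            mul_le_mul hsq h12 (by positivity) (by positivity)
        _ ≤ 3 * D₀ ^ 2 * (1 + R₁) ^ 2 := by nlinarith [sq_nonneg (1 + R₁)]
        _ ≤ K₂ := by rw [hK₂]; linarith
  -- the telescoping estimate with `q = 2`
  obtain ⟨CΓ, hCΓ0, hCΓ⟩ := exists_sq_mul_norm_fderiv_newtonFar_le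
  set V₁ : ℝ := (volume (ball (0 : EuclideanSpace ℝ (Fin 3)) 1)).toReal with hV₁
  have hV₁0 : 0 ≤ V₁ := ENNReal.toReal_nonneg
  set CP : ℝ := 16 * CΓ * K₂ * 2 ^ (2 : ℝ) * V₁ + 12 * CΓ * K₂ * V₁ * (20 : ℝ) ^ (3 - 2 : ℝ) / (3 - 2) * 8
    with hCP
  have hCP0 : 0 ≤ CP := by positivity
  refine ⟨g, CP, hCP0, hg, fun y hy => ?_⟩
  have hypos : 0 < ‖y‖ := by linarith
  refine FarFieldLimit.norm_le_of_forall_abs_inner_le (by positivity) fun e => ?_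
  rw [inner_sub_left, inner_gradient_left]
  have h := abs_fderiv_sub_inner_le hCΓ0 hCΓ hPinf hK₂0 (le_refl (2 : ℝ)) (by norm_num : (2 : ℝ) < 3) hΔ hg
    y hy e
  -- the two scale factors are `≤ 1/‖y‖` and `= 8/‖y‖`
  have hc1 : (1 + ‖y‖) ^ (1 - 2 : ℝ) ≤ 1 / ‖y‖ := by
    rw [show (1 : ℝ) - 2 = -1 by norm_num, Real.rpow_neg_one, one_div]
    exact inv_anti₀ hypos (by linarith)
  have hc2 : (‖y‖ / 8) ^ (1 - 2 : ℝ) = 8 / ‖y‖ := by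
    rw [show (1 : ℝ) - 2 = -1 by norm_num, Real.rpow_neg_one, inv_div]
  rw [hc2] at h
  refine h.trans ?_
  have hmono : 16 * CΓ * K₂ * 2 ^ (2 : ℝ) * V₁ * (1 + ‖y‖) ^ (1 - 2 : ℝ) ≤
      16 * CΓ * K₂ * 2 ^ (2 : ℝ) * V₁ * (1 / ‖y‖) := mul_le_mul_of_nonneg_left hc1 (by positivity)
  have hsum : (16 * CΓ * K₂ * 2 ^ (2 : ℝ) * V₁ * (1 + ‖y‖) ^ (1 - 2 : ℝ) +
      12 * CΓ * K₂ * V₁ * (20 : ℝ) ^ (3 - 2 : ℝ) / (3 - 2) * (8 / ‖y‖)) * ‖e‖ ≤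
      (16 * CΓ * K₂ * 2 ^ (2 : ℝ) * V₁ * (1 / ‖y‖) +
      12 * CΓ * K₂ * V₁ * (20 : ℝ) ^ (3 - 2 : ℝ) / (3 - 2) * (8 / ‖y‖)) * ‖e‖ :=
    mul_le_mul_of_nonneg_right (add_le_add hmono le_rfl) (norm_nonneg _)
  refine hsum.trans (le_of_eq ?_)
  rw [hCP]
  field_simp

/-- **K1c up to a logarithm, from K1a and `U → b` alone (the registered hypotheses of `stub_typeIRate`).**
For a bounded smooth div-free rotated Leray profile with scale-natural derivative decay (K1a) and far-field value
`b`, `‖U(y) − b‖ ≤ K(1 + log(1 + ‖y‖))/(1 + ‖y‖)` for all `y`.  The registered stub asks for `K/(1 + ‖y‖)`; the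
logarithm is the resonance of the CRITICAL forcing `‖∇P − g‖ ≤ C_P/r` (`norm_gradient_sub_le_of_scaleNaturalDecay`)
against the damping `e^{−as} = R/r` of the spiral transport (`transport_form_of_rotated`,
`norm_mul_norm_le_of_transport_linear_log_shift`).  HONEST FRAMING: this does NOT close K1c as registered; the
pure rate holds under third-order scale-natural decay (`typeIRate_of_third_order_decay`); K1a, `NoCoRotatingCore`,
Pineau–Vicol's conjecture and NS regularity are not touched. [cite: PineauVicol2026, Conj. 1.1, Prop. 3.1] -/
theorem typeIRate_log_of_scaleNaturalDecay (hν : 0 < ν) (ha : 0 < a)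
    (hB : ∀ x, inner ℝ (B x) x = 0) (hU : ContDiff ℝ (⊤ : ℕ∞) U) (hP : ContDiff ℝ 2 P)
    (hdiv : VectorCalculus.IsDivFree U)
    (heq : ∀ y, -(ν • (Δ U) y) + a • U y + a • fderiv ℝ U y y + (B (U y) - fderiv ℝ U y (B y)) +
      convect U U y + gradient P y = 0)
    (hbdd : ∃ M : ℝ, ∀ y, ‖U y‖ ≤ M)
    (hdecay : ∀ ε : ℝ, 0 < ε → ∃ R : ℝ, ∀ y : EuclideanSpace ℝ (Fin 3), R ≤ ‖y‖ →
      ‖y‖ * ‖fderiv ℝ U y‖ + ‖y‖ ^ 2 * ‖iteratedFDeriv ℝ 2 U y‖ ≤ ε)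
    (b : EuclideanSpace ℝ (Fin 3))
    (hlim : ∀ ε : ℝ, 0 < ε → ∃ R : ℝ, ∀ y : EuclideanSpace ℝ (Fin 3), R ≤ ‖y‖ → ‖U y - b‖ ≤ ε) :
    ∃ K : ℝ, ∀ y : EuclideanSpace ℝ (Fin 3),
      ‖U y - b‖ ≤ K * (1 + Real.log (1 + ‖y‖)) / (1 + ‖y‖) := by
  obtain ⟨g, CP, hCP0, hg, hrate⟩ :=
    norm_gradient_sub_le_of_scaleNaturalDecay hν ha hB hU hP hdiv heq hbdd hdecay
  have hgb : g = -(a • b + B b) := gradient_limit_eq hν ha hU heq hbdd hdecay hlim hg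
  obtain ⟨M, hM⟩ := hbdd
  have hU2 : ContDiff ℝ 2 U := hU.of_le (by norm_cast)
  have hUd : Differentiable ℝ U := hU.differentiable (by simp)
  have hWd : Differentiable ℝ (fun z => U z - b) := hUd.sub_const b
  -- the bound `m` on `W = U − b`
  obtain ⟨m, hm0, hWm⟩ : ∃ m : ℝ, 0 ≤ m ∧ ∀ z : EuclideanSpace ℝ (Fin 3), ‖U z - b‖ ≤ m :=
    ⟨M + ‖b‖, add_nonneg ((norm_nonneg _).trans (hM 0)) (norm_nonneg _),
      fun z => (norm_sub_le _ _).trans (add_le_add (hM z) le_rfl)⟩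
  -- the centre `c`: `a c − B c = −b`
  have hnegB : ∀ x, inner ℝ ((-B) x) x = 0 := fun x => by
    simp only [FunLike.coe_neg, Pi.neg_apply, inner_neg_left, hB x, neg_zero]
  obtain ⟨c, hc⟩ := FarFieldLimit.exists_add_clm_apply_eq_of_skew hnegB ha.ne' (-b)
  have hc' : a • c - B c = -b := by
    simpa only [FunLike.coe_neg, Pi.neg_apply, ← sub_eq_add_neg] using hc
  -- K1a at level `1`
  obtain ⟨R₁, hR₁1, hR₁⟩ := FarFieldLimit.exists_radius_decay hdecay one_pos
  -- the radius
  obtain ⟨R, hR1, hRc, hRR₁, hRa⟩ : ∃ R : ℝ, 1 ≤ R ∧ 2 * ‖c‖ + 2 ≤ R ∧ 2 * R₁ ≤ R ∧ 4 / a ≤ R := by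
    refine ⟨max (max (2 * ‖c‖ + 2) (2 * R₁)) (max (4 / a) 1), ?_, ?_, ?_, ?_⟩
    · exact (le_max_right _ _).trans (le_max_right _ _)
    · exact (le_max_left _ _).trans (le_max_left _ _)
    · exact (le_max_right _ _).trans (le_max_left _ _)
    · exact (le_max_left _ _).trans (le_max_right _ _)
  have hRpos : 0 < R := one_pos.trans_le hR1
  -- the transport inequality beyond `R` (critical pressure term)
  have hT : ∀ y : EuclideanSpace ℝ (Fin 3), R ≤ ‖y - c‖ →
      ‖fderiv ℝ (fun z => U z - b) y (a • (y - c) - B (y - c)) + (a • (U y - b) + B (U y - b))‖ ≤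
        2 * ‖U y - b‖ / ‖y - c‖ + (12 * ν) / ‖y - c‖ ^ 2 + (2 * CP) / ‖y - c‖ := by
    intro y hy
    have hyc : ‖y - c‖ / 2 ≤ ‖y‖ := by
      have h1 : ‖y - c‖ ≤ ‖y‖ + ‖c‖ := norm_sub_le y c
      linarith
    have hycpos : 0 < ‖y - c‖ := hRpos.trans_le hy
    have hypos : 0 < ‖y‖ := by linarith
    have hy1 : 1 ≤ ‖y‖ := by linarith
    have hyR₁ : R₁ ≤ ‖y‖ := by linarith
    obtain ⟨hD1, hD2⟩ := hR₁ y hyR₁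
    rw [transport_form_of_rotated heq hc' y]
    have t1 : ‖ν • (Δ U) y‖ ≤ 12 * ν / ‖y - c‖ ^ 2 := by
      rw [norm_smul, Real.norm_of_nonneg hν.le]
      have h1 := norm_laplacian_le_three_mul_norm_iteratedFDeriv_two hU2 y
      have h3 : 1 / ‖y‖ ^ 2 ≤ 4 / ‖y - c‖ ^ 2 := by
        rw [div_le_div_iff₀ (pow_pos hypos 2) (pow_pos hycpos 2)]
        nlinarith
      have h4 : ‖(Δ U) y‖ ≤ 3 * (4 / ‖y - c‖ ^ 2) := by linarith [hD2.trans h3]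
      have h5 := mul_le_mul_of_nonneg_left h4 hν.le
      have e : ν * (3 * (4 / ‖y - c‖ ^ 2)) = 12 * ν / ‖y - c‖ ^ 2 := by ring
      linarith
    have t2 : ‖fderiv ℝ U y (U y - b)‖ ≤ 2 * ‖U y - b‖ / ‖y - c‖ := by
      have h1 : ‖fderiv ℝ U y‖ ≤ 2 / ‖y - c‖ := by
        refine hD1.trans ?_
        rw [div_le_div_iff₀ hypos hycpos]
        linarith
      have h2 := ContinuousLinearMap.le_opNorm (fderiv ℝ U y) (U y - b)
      have h3 := mul_le_mul_of_nonneg_right h1 (norm_nonneg (U y - b))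
      have e : 2 / ‖y - c‖ * ‖U y - b‖ = 2 * ‖U y - b‖ / ‖y - c‖ := by ring
      linarith
    have t3 : ‖gradient P y + (a • b + B b)‖ ≤ 2 * CP / ‖y - c‖ := by
      have h := hrate y hy1
      rw [hgb, sub_neg_eq_add] at h
      refine h.trans ?_
      rw [div_le_div_iff₀ hypos hycpos]
      nlinarith
    have s1 := norm_sub_le (ν • (Δ U) y - fderiv ℝ U y (U y - b)) (gradient P y + (a • b + B b))
    have s2 := norm_sub_le (ν • (Δ U) y) (fderiv ℝ U y (U y - b))
    linarith
  -- the transport lemma with `κ = 2`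
  have hκR : (2 : ℝ) ≤ a * R / 2 := by
    have : 4 ≤ a * R := by rwa [div_le_iff₀' ha] at hRa
    linarith
  set A₀ : ℝ := R * m + 12 * ν / (a * R) with hA₀
  set B₀ : ℝ := Real.exp 1 * (2 * CP) / a with hB₀
  have hA₀0 : 0 ≤ A₀ := by positivity
  have hB₀0 : 0 ≤ B₀ := by positivity
  have hfar : ∀ y : EuclideanSpace ℝ (Fin 3), R ≤ ‖y - c‖ →
      ‖y - c‖ * ‖U y - b‖ ≤ 2 * (A₀ + B₀ * (1 + Real.log (‖y - c‖ / R))) := by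
    intro y hy
    have h := norm_mul_norm_le_of_transport_linear_log_shift ha hB hWd c hRpos zero_le_two hκR
      (by positivity : (0 : ℝ) ≤ 12 * ν) (by positivity : (0 : ℝ) ≤ 2 * CP) hWm hT y hy
    have e : R * m + 12 * ν / (a * R) + Real.exp 1 * (2 * CP) / a * (1 + Real.log (‖y - c‖ / R)) =
        A₀ + B₀ * (1 + Real.log (‖y - c‖ / R)) := by rw [hA₀, hB₀]
    linarith
  -- conversion to `K (1 + log(1 + ‖y‖))/(1 + ‖y‖)`
  set K : ℝ := max (2 * (A₀ + B₀ * (1 + Real.log (1 + ‖c‖))) * (2 + ‖c‖)) (m * (1 + R + ‖c‖)) with hK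
  refine ⟨K, fun y => ?_⟩
  have hypos1 : 0 < 1 + ‖y‖ := by positivity
  have hLy1 : 1 ≤ 1 + Real.log (1 + ‖y‖) := by
    have := Real.log_nonneg (by linarith [norm_nonneg y] : (1 : ℝ) ≤ 1 + ‖y‖)
    linarith
  have hyle : ‖y‖ ≤ ‖y - c‖ + ‖c‖ := by
    have h := norm_add_le (y - c) c
    rwa [sub_add_cancel] at h
  rw [le_div_iff₀ hypos1]
  by_cases hfar' : R ≤ ‖y - c‖
  · have hycpos : 0 < ‖y - c‖ := hRpos.trans_le hfar'
    -- `log(‖y − c‖/R) ≤ log(1 + ‖y‖) + log(1 + ‖c‖)`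
    have hlog : Real.log (‖y - c‖ / R) ≤ Real.log (1 + ‖y‖) + Real.log (1 + ‖c‖) := by
      rw [← Real.log_mul (by positivity) (by positivity)]
      refine Real.log_le_log (by positivity) ?_
      rw [div_le_iff₀ hRpos]
      have h1 : ‖y - c‖ ≤ ‖y‖ + ‖c‖ := norm_sub_le y c
      have h2 : ‖y‖ + ‖c‖ ≤ (1 + ‖y‖) * (1 + ‖c‖) := by
        nlinarith [mul_nonneg (norm_nonneg y) (norm_nonneg c)]
      have h3 : (1 + ‖y‖) * (1 + ‖c‖) ≤ (1 + ‖y‖) * (1 + ‖c‖) * R :=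
        le_mul_of_one_le_right (by positivity) hR1
      linarith
    have hlogc : 0 ≤ Real.log (1 + ‖c‖) := Real.log_nonneg (by linarith [norm_nonneg c])
    have hlogy : 0 ≤ Real.log (1 + ‖y‖) := Real.log_nonneg (by linarith [norm_nonneg y])
    have h1 : ‖y - c‖ * ‖U y - b‖ ≤
        2 * (A₀ + B₀ * (1 + Real.log (1 + ‖c‖))) * (1 + Real.log (1 + ‖y‖)) := by
      refine (hfar y hfar').trans ?_
      have h2 : B₀ * (1 + Real.log (‖y - c‖ / R)) ≤
          B₀ * (1 + Real.log (1 + ‖c‖)) * (1 + Real.log (1 + ‖y‖)) := by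
        have h3 : 1 + Real.log (‖y - c‖ / R) ≤ (1 + Real.log (1 + ‖c‖)) * (1 + Real.log (1 + ‖y‖)) := by
          nlinarith
        calc B₀ * (1 + Real.log (‖y - c‖ / R)) ≤ B₀ * ((1 + Real.log (1 + ‖c‖)) * (1 + Real.log (1 + ‖y‖))) :=
              mul_le_mul_of_nonneg_left h3 hB₀0
          _ = B₀ * (1 + Real.log (1 + ‖c‖)) * (1 + Real.log (1 + ‖y‖)) := by ring
      have h4 : A₀ ≤ A₀ * (1 + Real.log (1 + ‖y‖)) := le_mul_of_one_le_right hA₀0 hLy1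
      nlinarith
    have h2 : 1 + ‖y‖ ≤ ‖y - c‖ * (2 + ‖c‖) := by nlinarith [norm_nonneg c]
    have hpos2 : 0 ≤ 2 * (A₀ + B₀ * (1 + Real.log (1 + ‖c‖))) := by positivity
    calc ‖U y - b‖ * (1 + ‖y‖) ≤ ‖U y - b‖ * (‖y - c‖ * (2 + ‖c‖)) :=
          mul_le_mul_of_nonneg_left h2 (norm_nonneg _)
      _ = (‖y - c‖ * ‖U y - b‖) * (2 + ‖c‖) := by ring
      _ ≤ (2 * (A₀ + B₀ * (1 + Real.log (1 + ‖c‖))) * (1 + Real.log (1 + ‖y‖))) * (2 + ‖c‖) :=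
          mul_le_mul_of_nonneg_right h1 (by positivity)
      _ = (2 * (A₀ + B₀ * (1 + Real.log (1 + ‖c‖))) * (2 + ‖c‖)) * (1 + Real.log (1 + ‖y‖)) := by ring
      _ ≤ K * (1 + Real.log (1 + ‖y‖)) := by
          refine mul_le_mul_of_nonneg_right (le_max_left _ _) (by linarith)
  · rw [not_le] at hfar'
    have h2 : 1 + ‖y‖ ≤ 1 + R + ‖c‖ := by linarith
    calc ‖U y - b‖ * (1 + ‖y‖) ≤ m * (1 + R + ‖c‖) := mul_le_mul (hWm y) h2 hypos1.le hm0
      _ ≤ K := le_max_right _ _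
      _ = K * 1 := (mul_one K).symm
      _ ≤ K * (1 + Real.log (1 + ‖y‖)) :=
          mul_le_mul_of_nonneg_left hLy1 ((mul_nonneg hm0 (by positivity)).trans (le_max_right _ _))

end Profile

end TypeIRate

end Summit.NavierStokesRegularity.NavierStokesRegularity.Theorems.CoriolisHead

end
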